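import Summits.BirchSwinnertonDyer.BirchSwinnertonDyer.Theorems.ManinLocalTwoThreeManinPrimeToAdditiveFiveLeRedFiveSevenOfTwistFamilyItems
import Summits.BirchSwinnertonDyer.BirchSwinnertonDyer.Theorems.ManinLocalTwoThreeManinPrimeToAdditiveFiveLeDegreeUpSevenOfOrdinaryTwistLaw
import HarnessLib

/-!
# Route `ManinLocalTwoThree`, residual crux C5 `ManinPrimeToAdditiveFiveLe`
# (stmt-BirchSwinnertonDyer-22969), line `upper_anchor` (skeleton of record v12 bd42322545d00406):
# **the ledger of record on FOUR prints — Cremona's table and Česnavičius–Neururer–Saha leave C5's cone**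

Extra width seat bsd-line-ml23-c5-p1-w4 (gen 2), piece ρ, part 2/2 (part 1/2 = `…RedFiveSevenOfTwistFamilyItems.lean`:
core RED(57) UNCUT from K15b ∧ stmt-27552 ∧ K15a).

After gen 6 / ψ the by-name ledger of C5 (`…_of_sixPrints_of_twistFamilyItems_of_ordinaryTwistLaw`, p633601 §3; the
v13 candidate's composition) reads C5 ⟸ {F″, ČNS, Cremona ≤ 5·10⁵, EdK, EdG, MazurJ} ∧ 27071 ∧ 27552 ∧ 27072 ∧ E-imc-9(13).
Two of the six prints enter ONLY through the ♯-scaffolding of gens 2–3: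
* Cremona's table — through `coreRED57_of_cns_cremona_of_coreRED57sharp` (`N ≤ 5·10⁵` at 5, 7) and
  `coreRED13_of_cremona_of_coreRED13sharp` (`N ≤ 5·10⁵` at 13);
* ČNS Thm. 1.2 — through the same RED(57♯) bridge (`p ∤ deg φ`), the (5; II) flip-twin transport of p622240, and the
  `p ∣ deg φ` cut of stub 2 (p608852) feeding RED(11)/RED(13).
None of the by-name items, nor E-imc-9(13), nor Edixhoven's statements has a level or degree clause, so both cuts can be
dropped once the cores are re-derived uncut:

* §1 `coreRED13_of_edixhovenKodairaFact_of_ordinaryRamifiedTwistLaw'` — RED(13)′ (no `13 ∣ deg φ`, no `N > 5·10⁵`) ⟸ EdK ∧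
  E-imc-9(13): the lead's p618203 argument fed with the extra width seat w4 gen 0's GENERIC degree law
  `degreeUp_of_ordinaryRamifiedTwistLaw` (p627800); `coreRED13_of_edixhovenKodairaFact_of_ordinaryRamifiedTwistLaw` — the
  same in the `h13` shape of `coreRED11_of_mazurJ_of_coreRED13` (idle degree binder kept, level binder gone).
* §2 `reducibleTwistMinimal_of_edixhoven_mazurJ_of_cores` — stub 2 VERBATIM ⟸ EdK ∧ EdG ∧ MazurJ ∧ RED(57) ∧ RED(13)′,
  WITHOUT ČNS (Mazur's list empties the unstarred (G)-ordinary reducible locus at `p ∉ {5, 7, 13}`: p614544's lemmas).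
* §3 `maninPrimeToAdditiveFiveLe_of_fivePrints_of_twistFamilyItems_of_ordinaryTwistLaw` — the v13 composition with
  Cremona removed (ČNS kept: drop-in for the skeleton's `ManinPrimeToAdditiveFiveLe_of`), and
  `maninPrimeToAdditiveFiveLe_of_fourPrints_of_twistFamilyItems_of_ordinaryTwistLaw` — **C5 BY NAME ⟸ {F″, EdK, EdG, MazurJ}
  ∧ 27071 ∧ 27552 ∧ 27072 ∧ OrdinaryRamifiedTwistLaw 13** (kernel audit: `proof.conditional` on exactly these four
  Literature facts).

So C5's residual reads: the W[p]-IRREDUCIBLE locus rests on ONE derived reading of Kato (F″, referee-flagged); the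
W[p]-REDUCIBLE locus at `p ≥ 11` rests on Edixhoven 1991 Thm. 3 + Mazur 1978 Thm. 1 + E-imc-9(13); at `p ∈ {5, 7}` on the
three TFMD items. For the skeleton: `stub_printedInputs` may shrink from 7 conjuncts to 4 (F″, EdK, EdG, MazurJ) — the
lead's call. Why it matters: the dropped Cremona fact's docstring records the primary-source caveat (optimal curve
undetermined in 64 249 classes with `400000 < N ≤ 500000` in `manin.txt`); ČNS Thm. 1.2 was used only as a convenience cut.
HONEST STATUS: conditional results (`--supports … --as helper`) on OPEN items and cite-only prints; nothing here proves
C5, any TFMD item, E-imc-9, Manin's conjecture or BSD.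

References: [EdixhovenManin1991] Thm. 3, §4; [Mazur1978] Thm. 1; [Kato2004Asterisque] (8.1.3), Thm. 9.7;
[KostersPannekoek2017] Thm. 1; [ZagierCMB1985] §1; [SilvermanATAEC1994] IV Table 4.1; [CesnaviciusNeururerSaha2023] Thm. 1.2
(the cut that leaves); cell bsd-f2-manin MEMO-imc §10 (E-imc-9).
-/

set_option autoImplicit false
-- the Theorems namespace of this sub repeats the summit name by design (D-0017 nested layout)
set_option linter.dupNamespace false

noncomputable section

open scoped Classical NumberField

namespace Summit.BirchSwinnertonDyer.BirchSwinnertonDyer.Theorems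

open WeierstrassCurve IsDedekindDomain IsDedekindDomain.HeightOneSpectrum Rat.HeightOneSpectrum NumberField
  Literature.NumberTheory.EllipticCurves Literature.NumberTheory.EllipticCurves.ModularForms
  Literature.NumberTheory.EllipticCurves.Rank1Residual
  Literature.NumberTheory.DiophantineGeometry
  Summit.BirchSwinnertonDyer.Rank1Residual
  Summit.BirchSwinnertonDyer.Rank1Residual.ManinAdditive
  Summit.BirchSwinnertonDyer.Rank1Residual.Additive

/-! ## §1 Core RED(13) without the degree and level cuts, from EdK ∧ E-imc-9(13) -/

/-- **Core RED(13)′ — the `W[13]`-reducible residual at `13` WITHOUT the `13 ∣ deg φ` and `N > 5·10⁵` cuts — ⟸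
Edixhoven 1991 Thm. 3 (Kodaira half, cite-only `hEd`) ∧ E-imc-9 `OrdinaryRamifiedTwistLaw 13` (`hO`, the imc cell's
registered conjecture, taken as a hypothesis).** For `W` globally minimal with a lattice-optimal conductor-level datum `D`,
`13² ∣ N(W)`, globally twist-minimal, `W[13]` reducible, `ord₁₃ Δ_min(W) ≤ 4`, (G)-ordinary at `13`: `13 ∤ c(D)`. Proof =
the lead's p618203 `coreRED13sharp_of_edixhovenKodairaFact_of_degreeUp13Red` with the degree law supplied by the extra
width seat's GENERIC `degreeUp_of_ordinaryRamifiedTwistLaw` (p627800; no level, degree or reducibility binder): optimal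
`χ₁₃`-partner `(W₀, D₀)`, `N(W₀) = N(W)` by twist-minimality, `deg(D₀) = 13·deg(D)`, optimal-orbit trichotomy ⇒ commuting
with `W₀` the upper member, near-invariance ⇒ `v₁₃ c(D) = v₁₃ c(D₀) = 0` by `hEd` on the starred `W₀`. The reducibility
binder is carried, not used. Conditional result; closes nothing. [cite: EdixhovenManin1991, Thm. 3 and §4] [cite: ZagierCMB1985, §1] -/
theorem coreRED13_of_edixhovenKodairaFact_of_ordinaryRamifiedTwistLaw'
    (hEd : edixhoven_not_dvd_maninConstant_of_kodairaSymbol_ne) (hO : OrdinaryRamifiedTwistLaw 13) :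
    mazur_not_dvd_maninConstant_of_odd → abbesUllmo_not_dvd_maninConstant_of_not_dvd_level →
    cesnavicius_not_two_dvd_maninConstant_of_two_dvd_level → exists_isNewformOf →
    ∀ (W : WeierstrassCurve ℚ) [W.IsElliptic] [W.IsGloballyMinimal] [NeZero (W.conductorNorm ℤ)]
      (D : ModularParametrizationData W (W.conductorNorm ℤ)),
      IsLatticeOptimal D → ∀ p : ℕ, p.Prime → p = 13 → p ^ 2 ∣ W.conductorNorm ℤ →
      ¬ (∃ (W' : WeierstrassCurve ℚ) (q : ℕ), W'.IsElliptic ∧ W'.IsGloballyMinimal ∧ q.Prime ∧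
          q ≠ 2 ∧ q ^ 2 ∣ W.conductorNorm ℤ ∧
          IsIsogenous W (W'.quadraticTwist (((-1 : ℤ) ^ (q / 2) * q : ℤ) : ℚ)) ∧
          ¬ q ^ 2 ∣ W'.conductorNorm ℤ) →
      ¬ (∃ (W' : WeierstrassCurve ℚ) (d : ℤ), W'.IsElliptic ∧ W'.IsGloballyMinimal ∧
          (d = -1 ∨ d = 2 ∨ d = -2) ∧ 2 ^ 2 ∣ W.conductorNorm ℤ ∧
          IsIsogenous W (W'.quadraticTwist (d : ℚ)) ∧ ¬ 2 ^ 2 ∣ W'.conductorNorm ℤ) →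
      ¬ W.HasIrreducibleModPGaloisRep p →
      padicValInt p W.minimalDiscriminantInt ≤ 4 →
      (∃ (L : Type) (_ : Field L) (_ : NumberField L) (_ : IsCyclotomicExtension {p} ℚ L)
          (F : IntermediateField ℚ L),
          ∀ w : HeightOneSpectrum (𝓞 F), (p : 𝓞 F) ∈ w.asIdeal →
            (W.baseChange F).HasGoodReductionAt w ∧ (W.baseChange F).HasUnitRootAt w) →
      ¬ (p : ℤ) ∣ D.maninConstant := by
  intro _hM _hAU _hC hnf W _ _ _ D hD p hp hp13 hpN hodd _hdy _hred hlow hGo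
  subst hp13
  haveI : Fact (Nat.Prime 13) := ⟨hp⟩
  have h5 : 5 ≤ 13 := by norm_num
  have hd0 : ((((-1 : ℤ) ^ (13 / 2) * 13 : ℤ)) : ℚ) ≠ 0 := by norm_num
  haveI : (W.quadraticTwist (((-1 : ℤ) ^ (13 / 2) * 13 : ℤ) : ℚ)).IsElliptic :=
    W.isElliptic_quadraticTwist hd0
  -- (G)-ordinary ⟹ potentially good ordinary in the tree's sense
  have hpo : W.HasPotentiallyGoodOrdinaryReductionAtPrime 13 := by
    obtain ⟨L, iF, iN, iC, F, hF⟩ := hGo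
    haveI : NumberField F := NumberField.of_module_finite ℚ F
    obtain ⟨w, hw⟩ := exists_heightOneSpectrum_natCast_mem F 13
    exact ⟨F, inferInstance, inferInstance, w, hw, hF w hw⟩
  have hv6 : padicValInt 13 W.minimalDiscriminantInt < 6 := by omega
  -- the lattice-optimal globally minimal curve `W₀` of the class of `W ⊗ 13`
  obtain ⟨W₀, hE₀, hM₀, hne₀, D₀, hD₀, hiso⟩ :=
    exists_isIsogenous_latticeOptimal hnf (W.quadraticTwist (((-1 : ℤ) ^ (13 / 2) * 13 : ℤ) : ℚ))
  haveI := hE₀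
  haveI := hM₀
  haveI := hne₀
  haveI : (W₀.quadraticTwist (((-1 : ℤ) ^ (13 / 2) * 13 : ℤ) : ℚ)).IsElliptic :=
    W₀.isElliptic_quadraticTwist hd0
  -- `W ∼ W₀ ⊗ 13`
  have htw : IsIsogenous W (W₀.quadraticTwist (((-1 : ℤ) ^ (13 / 2) * 13 : ℤ) : ℚ)) := by
    obtain ⟨C, hC⟩ := W.exists_variableChange_smul_eq_quadraticTwist_sq hd0
    have h1 : IsIsogenous W ((W.quadraticTwist (((-1 : ℤ) ^ (13 / 2) * 13 : ℤ) : ℚ)).quadraticTwist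
        (((-1 : ℤ) ^ (13 / 2) * 13 : ℤ) : ℚ)) := by
      rw [quadraticTwist_quadraticTwist, ← sq, ← hC]
      exact isIsogenous_smul _ _
    exact h1.trans' (hiso.quadraticTwist hd0)
  -- twist-minimality of `W` at `13`: `13² ∣ N(W₀)`; hence `N(W₀) = N(W)`
  have hpN₀ : 13 ^ 2 ∣ W₀.conductorNorm ℤ := by
    by_contra h
    exact hodd ⟨W₀, 13, hE₀, hM₀, hp, by norm_num, hpN, htw, h⟩
  have hNN : W₀.conductorNorm ℤ = W.conductorNorm ℤ :=
    conductorNorm_eq_of_isIsogenous_twist_pStar_of_sq_dvd hnf (by norm_num) htw hpN hpN₀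
  -- the degree law `deg(D₀) = 13 · deg(D)` from E-imc-9(13) (generic, no level / degree binders: p627800)
  have hup : D₀.modularDegree = 13 * D.modularDegree :=
    degreeUp_of_ordinaryRamifiedTwistLaw hO hnf hp h5 W D hD hpN hpo hv6 W₀ D₀ hD₀ hNN hiso
  have hpos : 0 < D.modularDegree := D.deg_pos
  -- the optimal-orbit trichotomy: only the commuting-up case is compatible with the degree law
  rcases pStar_optimal_orbit_trichotomy_full hp (by norm_num) W W₀ D D₀ hD hD₀ hpN hNN hiso with
    ⟨⟨u, hu⟩, -, -⟩ | ⟨-, hdeg₂, -⟩ | hdeg₃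
  · rcases pStar_optimal_commuting_manin_near_invariance hp (by norm_num) W W₀ u D D₀ hD hD₀ hpN hNN hu
      with ⟨-, ⟨hc, hΔ⟩ | ⟨-, hΔ⟩⟩ | ⟨hdeg₂, -⟩
    · -- `v₁₃ c₀ = v₁₃ c` and `W₀` is the UPPER member: Edixhoven's Kodaira statement applies to `(W₀, D₀)`
      have hnd : ¬ ((13 : ℕ) : ℤ) ∣ D₀.maninConstant :=
        upperAnchor_of_edixhovenKodairaFact_red hEd hp (by norm_num) W W₀ u D₀ hD₀ hpN hNN hu hΔ
      have hv₀ : padicValInt 13 D₀.c = 0 := padicValInt.eq_zero_of_not_dvd hnd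
      have hc0 : D.c ≠ 0 := Int.cast_ne_zero.mp D.cast_c_ne_zero
      intro h13
      have h13' : ((13 : ℕ) : ℤ) ^ 1 ∣ D.c := by rw [pow_one]; exact h13
      rcases (padicValInt_dvd_iff 1 D.c).mp h13' with h | h
      · exact hc0 h
      · omega
    · omega
    · omega
  · omega
  · omega

/-- **Core RED(13) in the shape consumed by `coreRED11_of_mazurJ_of_coreRED13` (hypothesis `h13`, p612408, VERBATIM:
with the idle `13 ∣ deg φ` binder, WITHOUT `N > 5·10⁵`) ⟸ EdK ∧ E-imc-9(13)** — §1 weakened by one unused binder. Replaces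
`coreRED13_of_cremona_of_coreRED13sharp h500k (red13sharp_of_edixhovenKodairaFact_of_ordinaryRamifiedTwistLaw hEdK hO13)`
in every ledger, i.e. removes Cremona's table from the `p = 13` branch. Conditional result. [cite: EdixhovenManin1991, Thm. 3 and §4] -/
theorem coreRED13_of_edixhovenKodairaFact_of_ordinaryRamifiedTwistLaw
    (hEd : edixhoven_not_dvd_maninConstant_of_kodairaSymbol_ne) (hO : OrdinaryRamifiedTwistLaw 13) :
    mazur_not_dvd_maninConstant_of_odd → abbesUllmo_not_dvd_maninConstant_of_not_dvd_level →
    cesnavicius_not_two_dvd_maninConstant_of_two_dvd_level → exists_isNewformOf →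
    ∀ (W : WeierstrassCurve ℚ) [W.IsElliptic] [W.IsGloballyMinimal] [NeZero (W.conductorNorm ℤ)]
      (D : ModularParametrizationData W (W.conductorNorm ℤ)),
      IsLatticeOptimal D → ∀ p : ℕ, p.Prime → p = 13 → p ^ 2 ∣ W.conductorNorm ℤ →
      ¬ (∃ (W' : WeierstrassCurve ℚ) (q : ℕ), W'.IsElliptic ∧ W'.IsGloballyMinimal ∧ q.Prime ∧
          q ≠ 2 ∧ q ^ 2 ∣ W.conductorNorm ℤ ∧
          IsIsogenous W (W'.quadraticTwist (((-1 : ℤ) ^ (q / 2) * q : ℤ) : ℚ)) ∧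
          ¬ q ^ 2 ∣ W'.conductorNorm ℤ) →
      ¬ (∃ (W' : WeierstrassCurve ℚ) (d : ℤ), W'.IsElliptic ∧ W'.IsGloballyMinimal ∧
          (d = -1 ∨ d = 2 ∨ d = -2) ∧ 2 ^ 2 ∣ W.conductorNorm ℤ ∧
          IsIsogenous W (W'.quadraticTwist (d : ℚ)) ∧ ¬ 2 ^ 2 ∣ W'.conductorNorm ℤ) →
      ¬ W.HasIrreducibleModPGaloisRep p →
      padicValInt p W.minimalDiscriminantInt ≤ 4 →
      (∃ (L : Type) (_ : Field L) (_ : NumberField L) (_ : IsCyclotomicExtension {p} ℚ L)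
          (F : IntermediateField ℚ L),
          ∀ w : HeightOneSpectrum (𝓞 F), (p : 𝓞 F) ∈ w.asIdeal →
            (W.baseChange F).HasGoodReductionAt w ∧ (W.baseChange F).HasUnitRootAt w) →
      p ∣ D.modularDegree →
      ¬ (p : ℤ) ∣ D.maninConstant :=
  fun hM hAU hC hnf W _ _ _ D hD p hp hp13 hpN hodd hdy hred hlow hGo _ ↦
    coreRED13_of_edixhovenKodairaFact_of_ordinaryRamifiedTwistLaw' hEd hO hM hAU hC hnf W D hD p hp hp13 hpN
      hodd hdy hred hlow hGo

/-! ## §2 Stub 2 without Česnavičius–Neururer–Saha -/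

/-- **Stub 2 `stub_reducibleTwistMinimal` of line `upper_anchor` (skeleton v3; = hypothesis `hRED` of
`maninLocalTwoThree_maninPrimeToAdditiveFiveLe_of_kato57_of_cores`, p611587, VERBATIM) ⟸ Edixhoven 1991 Thm. 3 (both
cite-only halves `hK`, `hG`) ∧ Mazur 1978 Thm. 1 with the `X₀(p)(ℚ)` `j`-list (`hJ`, cite-only) ∧ core RED(57) (`h57`,
uncut) ∧ core RED(13)′ (`h13`, uncut) — NO Česnavičius–Neururer–Saha.** The width seat's p608852
`reducibleTwistMinimal_of_edixhoven_cns_of_cores` with its ČNS cut replaced by Mazur's list: at `p > 7`, unstarred and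
(G)-ordinary, either `p = 13` (`h13`) or the curve does not exist (`p ∉ {13, 37}`: potentially SUPERSINGULAR by
`not_typeGOrd_of_not_hasIrreducibleModPGaloisRep_of_eleven_le`; `p = 37`: starred by
`four_lt_padicValInt_of_not_hasIrreducibleModPGaloisRep_thirtySeven`; both p614544); not (G)-ordinary: `hG`; starred: `hK`.
Conditional result; closes nothing. [cite: EdixhovenManin1991, Thm. 3] [cite: Mazur1978, Thm. 1] [cite: SilvermanATAEC1994, IV Table 4.1] -/
theorem reducibleTwistMinimal_of_edixhoven_mazurJ_of_cores
    (hK : edixhoven_not_dvd_maninConstant_of_kodairaSymbol_ne)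
    (hG : edixhoven_not_dvd_maninConstant_of_not_potentiallyGoodOrdinary)
    (hJ : mazur_j_mem_of_not_hasIrreducibleModPGaloisRep_of_eleven_le)
    (h57 : mazur_not_dvd_maninConstant_of_odd → abbesUllmo_not_dvd_maninConstant_of_not_dvd_level →
      cesnavicius_not_two_dvd_maninConstant_of_two_dvd_level → exists_isNewformOf →
      ∀ (W : WeierstrassCurve ℚ) [W.IsElliptic] [W.IsGloballyMinimal] [NeZero (W.conductorNorm ℤ)]
        (D : ModularParametrizationData W (W.conductorNorm ℤ)),
        IsLatticeOptimal D → ∀ p : ℕ, p.Prime → (p = 5 ∨ p = 7) → p ^ 2 ∣ W.conductorNorm ℤ →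
        ¬ (∃ (W' : WeierstrassCurve ℚ) (q : ℕ), W'.IsElliptic ∧ W'.IsGloballyMinimal ∧ q.Prime ∧
            q ≠ 2 ∧ q ^ 2 ∣ W.conductorNorm ℤ ∧
            IsIsogenous W (W'.quadraticTwist (((-1 : ℤ) ^ (q / 2) * q : ℤ) : ℚ)) ∧
            ¬ q ^ 2 ∣ W'.conductorNorm ℤ) →
        ¬ (∃ (W' : WeierstrassCurve ℚ) (d : ℤ), W'.IsElliptic ∧ W'.IsGloballyMinimal ∧
            (d = -1 ∨ d = 2 ∨ d = -2) ∧ 2 ^ 2 ∣ W.conductorNorm ℤ ∧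
            IsIsogenous W (W'.quadraticTwist (d : ℚ)) ∧ ¬ 2 ^ 2 ∣ W'.conductorNorm ℤ) →
        ¬ W.HasIrreducibleModPGaloisRep p →
        ¬ (p : ℤ) ∣ D.maninConstant)
    (h13 : mazur_not_dvd_maninConstant_of_odd → abbesUllmo_not_dvd_maninConstant_of_not_dvd_level →
      cesnavicius_not_two_dvd_maninConstant_of_two_dvd_level → exists_isNewformOf →
      ∀ (W : WeierstrassCurve ℚ) [W.IsElliptic] [W.IsGloballyMinimal] [NeZero (W.conductorNorm ℤ)]
        (D : ModularParametrizationData W (W.conductorNorm ℤ)),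
        IsLatticeOptimal D → ∀ p : ℕ, p.Prime → p = 13 → p ^ 2 ∣ W.conductorNorm ℤ →
        ¬ (∃ (W' : WeierstrassCurve ℚ) (q : ℕ), W'.IsElliptic ∧ W'.IsGloballyMinimal ∧ q.Prime ∧
            q ≠ 2 ∧ q ^ 2 ∣ W.conductorNorm ℤ ∧
            IsIsogenous W (W'.quadraticTwist (((-1 : ℤ) ^ (q / 2) * q : ℤ) : ℚ)) ∧
            ¬ q ^ 2 ∣ W'.conductorNorm ℤ) →
        ¬ (∃ (W' : WeierstrassCurve ℚ) (d : ℤ), W'.IsElliptic ∧ W'.IsGloballyMinimal ∧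
            (d = -1 ∨ d = 2 ∨ d = -2) ∧ 2 ^ 2 ∣ W.conductorNorm ℤ ∧
            IsIsogenous W (W'.quadraticTwist (d : ℚ)) ∧ ¬ 2 ^ 2 ∣ W'.conductorNorm ℤ) →
        ¬ W.HasIrreducibleModPGaloisRep p →
        padicValInt p W.minimalDiscriminantInt ≤ 4 →
        (∃ (L : Type) (_ : Field L) (_ : NumberField L) (_ : IsCyclotomicExtension {p} ℚ L)
            (F : IntermediateField ℚ L),
            ∀ w : HeightOneSpectrum (𝓞 F), (p : 𝓞 F) ∈ w.asIdeal →
              (W.baseChange F).HasGoodReductionAt w ∧ (W.baseChange F).HasUnitRootAt w) →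
        ¬ (p : ℤ) ∣ D.maninConstant) :
    mazur_not_dvd_maninConstant_of_odd → abbesUllmo_not_dvd_maninConstant_of_not_dvd_level →
    cesnavicius_not_two_dvd_maninConstant_of_two_dvd_level → exists_isNewformOf →
    ∀ (W : WeierstrassCurve ℚ) [W.IsElliptic] [W.IsGloballyMinimal] [NeZero (W.conductorNorm ℤ)]
      (D : ModularParametrizationData W (W.conductorNorm ℤ)),
      IsLatticeOptimal D → ∀ p : ℕ, p.Prime → 5 ≤ p → p ^ 2 ∣ W.conductorNorm ℤ →
      ¬ (∃ (W' : WeierstrassCurve ℚ) (q : ℕ), W'.IsElliptic ∧ W'.IsGloballyMinimal ∧ q.Prime ∧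
          q ≠ 2 ∧ q ^ 2 ∣ W.conductorNorm ℤ ∧
          IsIsogenous W (W'.quadraticTwist (((-1 : ℤ) ^ (q / 2) * q : ℤ) : ℚ)) ∧
          ¬ q ^ 2 ∣ W'.conductorNorm ℤ) →
      ¬ (∃ (W' : WeierstrassCurve ℚ) (d : ℤ), W'.IsElliptic ∧ W'.IsGloballyMinimal ∧
          (d = -1 ∨ d = 2 ∨ d = -2) ∧ 2 ^ 2 ∣ W.conductorNorm ℤ ∧
          IsIsogenous W (W'.quadraticTwist (d : ℚ)) ∧ ¬ 2 ^ 2 ∣ W'.conductorNorm ℤ) →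
      ¬ W.HasIrreducibleModPGaloisRep p →
      ¬ (p : ℤ) ∣ D.maninConstant := by
  intro hM hAU hC hnf W _ _ _ D hD p hp h5 hpN hodd hdy hred
  haveI hpF : Fact p.Prime := ⟨hp⟩
  by_cases h57p : p = 5 ∨ p = 7
  · exact h57 hM hAU hC hnf W D hD p hp h57p hpN hodd hdy hred
  · -- a prime `p ≥ 5` other than `5, 7` exceeds `7`
    have h7 : 7 < p := by
      obtain ⟨hp5, hp7⟩ := not_or.mp h57p
      have hp6 : p ≠ 6 := by rintro rfl; norm_num at hp
      omega
    have hadd : Addv W p := not_good_and_not_mult_of_sq_dvd_conductorNorm W hpN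
    by_cases hlow : padicValInt p W.minimalDiscriminantInt ≤ 4
    · -- unstarred (Kodaira II / III / IV): split on the (G)-ordinary clause
      by_cases hGo : ∃ (L : Type) (_ : Field L) (_ : NumberField L)
          (_ : IsCyclotomicExtension {p} ℚ L) (F : IntermediateField ℚ L),
          ∀ w : HeightOneSpectrum (𝓞 F), (p : 𝓞 F) ∈ w.asIdeal →
            (W.baseChange F).HasGoodReductionAt w ∧ (W.baseChange F).HasUnitRootAt w
      · -- (G)-ordinary: Mazur's list leaves only `p = 13` (elsewhere potentially supersingular, or starred at 37)
        by_cases hp13 : p = 13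
        · exact h13 hM hAU hC hnf W D hD p hp hp13 hpN hodd hdy hred hlow hGo
        · exfalso
          have h11 : 11 ≤ p := by
            by_contra h11
            interval_cases p <;> exact absurd hp (by norm_num)
          by_cases hp37 : p = 37
          · subst hp37
            have hlt := four_lt_padicValInt_of_not_hasIrreducibleModPGaloisRep_thirtySeven W hJ hadd hred
            omega
          · exact not_typeGOrd_of_not_hasIrreducibleModPGaloisRep_of_eleven_le W p hJ h11 hp13 hp37 hadd
              hred hGo
      · exact hG W D hD p hp h7 hGo
    · -- starred (`ord_p Δ_min > 4`): the Kodaira-type fact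
      have hnot : ¬ (W.kodairaSymbolAt (placeOf p) = .II ∨ W.kodairaSymbolAt (placeOf p) = .III ∨
          W.kodairaSymbolAt (placeOf p) = .IV) :=
        fun h ↦ hlow ((kodairaSymbolAt_placeOf_II_or_III_or_IV_iff_of_addv W p h5 hadd).mp h)
      have h2 : W.kodairaSymbolAt (placeOf p) ≠ .II := fun h ↦ hnot (Or.inl h)
      have h3 : W.kodairaSymbolAt (placeOf p) ≠ .III := fun h ↦ hnot (Or.inr (Or.inl h))
      have h4 : W.kodairaSymbolAt (placeOf p) ≠ .IV := fun h ↦ hnot (Or.inr (Or.inr h))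
      exact hK W D hD p hp h7 h2 h3 h4

/-! ## §3 The ledgers: five prints (Cremona gone), four prints (Cremona and ČNS gone) -/

/-- **Crux C5 BY NAME ⟸ FIVE cite-only prints {Kato F″, ČNS Thm. 1.2, Edixhoven Thm. 3 (Kodaira half, ordinarity half),
Mazur 1978 Thm. 1} ∧ K15b (stmt-27071) ∧ `OrdinaryCornerManinResidual` (stmt-27552) ∧ K15a (stmt-27072) ∧ E-imc-9
`OrdinaryRamifiedTwistLaw 13`** — the width seat's `…_of_sixPrints_of_twistFamilyItems_of_ordinaryTwistLaw` (p633601 §3, the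
v13 candidate's composition) with Cremona's table REMOVED: RED(57) uncut (part 1/2) and RED(13) from §1; the ČNS cut of p608852
kept. Conditional result (`--supports`, helper); closes nothing. [cite: Kato2004Asterisque, Thm. 9.7]
[cite: CesnaviciusNeururerSaha2023, Thm. 1.2] [cite: EdixhovenManin1991, Thm. 3] [cite: Mazur1978, Thm. 1] -/
theorem maninPrimeToAdditiveFiveLe_of_fivePrints_of_twistFamilyItems_of_ordinaryTwistLaw
    (hK57 : kato_neron_isIntegral_twistedSymbolSum_of_additive_five_le)
    (hCNS : cesnaviciusNeururerSaha_padicVal_maninConstant_le_modularDegree)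
    (hEdK : edixhoven_not_dvd_maninConstant_of_kodairaSymbol_ne)
    (hEdG : edixhoven_not_dvd_maninConstant_of_not_potentiallyGoodOrdinary)
    (hJ : mazur_j_mem_of_not_hasIrreducibleModPGaloisRep_of_eleven_le)
    (hK15b : Summit.BirchSwinnertonDyer.BirchSwinnertonDyer.Theses.TwistFamilyManinDescent.SupersingularUnstarredStrongManinUnit)
    (hOrd : Summit.BirchSwinnertonDyer.BirchSwinnertonDyer.Theses.TwistFamilyManinDescent.OrdinaryCornerManinResidual)
    (hK15a : Summit.BirchSwinnertonDyer.BirchSwinnertonDyer.Theses.TwistFamilyManinDescent.SupersingularStrongIsUnstarred)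
    (hO13 : OrdinaryRamifiedTwistLaw 13) :
    Summit.BirchSwinnertonDyer.BirchSwinnertonDyer.Theses.ManinLocalTwoThree.ManinPrimeToAdditiveFiveLe := by
  have h57 := coreRED57_of_twistFamilyItems hK15b hOrd hK15a
  have h11 := coreRED11_of_mazurJ_of_coreRED13 hJ
    (coreRED13_of_edixhovenKodairaFact_of_ordinaryRamifiedTwistLaw hEdK hO13)
  intro hM hAU hC hnf
  exact maninLocalTwoThree_maninPrimeToAdditiveFiveLe_of_kato57_of_cores hK57 (coreKP_of_kato hnf hK57)
    (reducibleTwistMinimal_of_edixhoven_cns_of_cores hEdK hEdG hCNS h57 h11) hM hAU hC hnf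

/-- **Crux C5 `ManinLocalTwoThree.ManinPrimeToAdditiveFiveLe` BY NAME ⟸ FOUR cite-only prints {Kato F″
`kato_neron_isIntegral_twistedSymbolSum_of_additive_five_le`, Edixhoven 1991 Thm. 3 Kodaira half
`edixhoven_not_dvd_maninConstant_of_kodairaSymbol_ne` and ordinarity half `edixhoven_not_dvd_maninConstant_of_not_potentiallyGoodOrdinary`,
Mazur 1978 Thm. 1 `mazur_j_mem_of_not_hasIrreducibleModPGaloisRep_of_eleven_le`} ∧ K15b (stmt-27071) ∧
`OrdinaryCornerManinResidual` (stmt-27552) ∧ K15a (stmt-27072) ∧ E-imc-9 `OrdinaryRamifiedTwistLaw 13`.** THE LEDGER OF ρ: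
irreducible locus `coreKP_of_kato` (modularity ∧ F″), reducible residual §2 over RED(57) uncut (part 1/2) and RED(13)′ (§1).
Neither Česnavičius–Neururer–Saha nor Cremona's table nor Dokchitser–Dokchitser nor Gealy–Klagsbrun is a hypothesis.
Conditional result (`--supports`, helper): the four prints are cite-only, 27071 / 27552 / 27072 / E-imc-9(13) are OPEN;
C5 is NOT proved; Manin's conjecture and BSD are not proved. [cite: Kato2004Asterisque, (8.1.3) and Thm. 9.7]
[cite: EdixhovenManin1991, Thm. 3] [cite: Mazur1978, Thm. 1] [cite: KostersPannekoek2017, Thm. 1] -/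
theorem maninPrimeToAdditiveFiveLe_of_fourPrints_of_twistFamilyItems_of_ordinaryTwistLaw
    (hK57 : kato_neron_isIntegral_twistedSymbolSum_of_additive_five_le)
    (hEdK : edixhoven_not_dvd_maninConstant_of_kodairaSymbol_ne)
    (hEdG : edixhoven_not_dvd_maninConstant_of_not_potentiallyGoodOrdinary)
    (hJ : mazur_j_mem_of_not_hasIrreducibleModPGaloisRep_of_eleven_le)
    (hK15b : Summit.BirchSwinnertonDyer.BirchSwinnertonDyer.Theses.TwistFamilyManinDescent.SupersingularUnstarredStrongManinUnit)
    (hOrd : Summit.BirchSwinnertonDyer.BirchSwinnertonDyer.Theses.TwistFamilyManinDescent.OrdinaryCornerManinResidual)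
    (hK15a : Summit.BirchSwinnertonDyer.BirchSwinnertonDyer.Theses.TwistFamilyManinDescent.SupersingularStrongIsUnstarred)
    (hO13 : OrdinaryRamifiedTwistLaw 13) :
    Summit.BirchSwinnertonDyer.BirchSwinnertonDyer.Theses.ManinLocalTwoThree.ManinPrimeToAdditiveFiveLe := by
  intro hM hAU hC hnf
  exact maninLocalTwoThree_maninPrimeToAdditiveFiveLe_of_kato57_of_cores hK57 (coreKP_of_kato hnf hK57)
    (reducibleTwistMinimal_of_edixhoven_mazurJ_of_cores hEdK hEdG hJ (coreRED57_of_twistFamilyItems hK15b hOrd hK15a)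
      (coreRED13_of_edixhovenKodairaFact_of_ordinaryRamifiedTwistLaw' hEdK hO13)) hM hAU hC hnf

end Summit.BirchSwinnertonDyer.BirchSwinnertonDyer.Theorems

end
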